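import Literature.Analysis.FluidPDE.TaoCascadeReducedClaimExit
import Literature.Analysis.FluidPDE.TaoCascadeRescaledStepOrder
import Literature.Analysis.FluidPDE.TaoCascadeSmallScaleOneInRegime
import HarnessLib

/-!
# Tao's cascade ODE: the corrected Prop. 6.3 (`blowupDynamicsCorrected`) from the reductions of §6.4–6.5

T. Tao, *Finite time blowup for an averaged three-dimensional Navier–Stokes equation*,
J. Amer. Math. Soc. 29 (2016), 601–674 = arXiv:1402.0290v3, §6.2–6.5. The named fact
`blowupDynamicsCorrected` (`TaoCascadeBlowupDynamicsWith.lean`: Prop. 6.3 with the author-corrected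
coefficient `10⁻⁵ exp(-K¹⁰/2)` in (6.17)) follows from the corrected Prop. 6.4
(`blowupDynamicsWith_of_blowupDynamicsStepWith`, §6.3, that file), which follows from the corrected
Prop. 6.5 in the form `rescaledStepCorrected'` (§6.4, `TaoCascadeRescaledStepOrder.lean`), which in
turn follows from the corrected Prop. 6.12 `reducedClaimCorrected` (§6.5,
`TaoCascadeReducedClaimExit.lean`). This file records the two composite reductions; the proof of
Prop. 6.12 (§6.6–6.7) then discharges `blowupDynamicsCorrected` by one application. With Prop. 6.13
proved in the regime (`smallScaleOneInput_holds`, `TaoCascadeSmallScaleOneInRegime.lean`, from the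
repaired Prop. 6.13 of `TaoCascadeScaleOneRegime.lean`) and the assembly of Prop. 6.12 from
Props. 6.13/6.15 (`TaoCascadeReducedClaimAssembly.lean`), the corrected Prop. 6.3 is further reduced to
Prop. 6.15 in the regime alone (`blowupDynamicsCorrected_of_reducedClaimIIInput`).

## References

* T. Tao, arXiv:1402.0290v3, §6.2 Prop. 6.3, §6.3 Prop. 6.4, §6.4 Prop. 6.5, §6.5 Prop. 6.12.
  [`Tao2016AveragedNS`]
-/

noncomputable section

namespace Literature.Analysis.FluidPDE

namespace TaoCascade

/-- **Corrected Prop. 6.3 ⇐ corrected Prop. 6.5** (in the form `rescaledStepCorrected'`, implied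
constant of (6.53) fixed before `K₀`). [cite: Tao2016AveragedNS, §6.2–6.4] -/
theorem blowupDynamicsCorrected_of_rescaledStepCorrected' (h : rescaledStepCorrected') :
    blowupDynamicsCorrected :=
  blowupDynamicsWith_of_blowupDynamicsStepWith (fun K _ => by positivity)
    (blowupDynamicsStepWith_of_rescaledStepWith' h)

/-- **Corrected Prop. 6.3 ⇐ corrected Prop. 6.12** (`reducedClaimCorrected`).
[cite: Tao2016AveragedNS, §6.2–6.5] -/
theorem blowupDynamicsCorrected_of_reducedClaimCorrected (h : reducedClaimCorrected) :
    blowupDynamicsCorrected :=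
  blowupDynamicsCorrected_of_rescaledStepCorrected' (rescaledStepCorrected'_of_reducedClaimCorrected h)

/-- **Corrected Prop. 6.3 ⇐ Prop. 6.15 in the regime** (`ReducedClaimIIInput`): Props. 6.4, 6.5, 6.12,
6.13, Lemmas 6.7–6.10, Cors. 6.11, 6.14 being proved, the reduced claim II of §6.6 is all that
remains of Thm. 6.2/Prop. 6.3 (corrected). [cite: Tao2016AveragedNS, §6.2–6.6] -/
theorem blowupDynamicsCorrected_of_reducedClaimIIInput (h : ReducedClaimIIInput) :
    blowupDynamicsCorrected :=
  blowupDynamicsCorrected_of_rescaledStepCorrected' (rescaledStepCorrected'_of_reducedClaimIIInput h)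

end TaoCascade

end Literature.Analysis.FluidPDE
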